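import Summits.CriticalPhenomena.PercolationContinuityZ3.Theorems.PercNearOneGluingNoHeavyLowerTailKnQuestion8CoefficientwiseNoCoreNbhd
import HarnessLib

/-!
# Monochromatic connected gadgets: the part of NO-CORE(y) where a connected edge set `R ∋ u, y` is entirely red is nonnegative — prim-lf-2 gen 48

Support file (`--supports stmt-CriticalPhenomena-4575`, closed), prover `prim-lf-2` (gen 48).  No definitions, no named facts, no sorries; standard axioms.
Memo `prim-lf-2/CW-HT-gen48.md` §3d.  Generalises `…KnQuestion8CoefficientwiseStarClass.lean` (there `R` = one edge `yu`).

Setting.  Finite multigraph `ends : ι → Sym2 V`, root `x`, `K(s) = openCluster (ends '' s) x`, `f = 1[u ∈ ·]`, `g` monotone; `J(s) = K(s) ∩ K(sᶜ)`.  Let `R` be a finite set of edges that is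
CONNECTED FROM `u` (every end of every edge of `R` is joined to `u` by `R`-edges) and let `y` be joined to `u` by `R`-edges.  THEOREM (`gadgetClass_nonneg`):
  `0 ≤ Σ_{s ⊇ R : y ∉ J(s)} ([u ∈ K s] − [u ∈ K sᶜ])·(g(K s) − g(K sᶜ))`   — the colour class 'all of `R` red' of NO-CORE(y) (and, by the colour swap, 'all of `R` blue') is `≥ 0`,
for every monotone `g` and every finite multigraph, whatever the distance from `u` to `y`.
Proof = the four brackets of the star-class theorem on the sub-cube `r ⊆ ι ∖ R` with `a(r) = K(r⁺ ∪ R)`, `b(r) = K((rᶜ)⁺)`: the red gadget ties `[y ∈ a] = [u ∈ a]` (`gadget_tie`), and on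
`{u ∉ K(T ∪ R)}` the whole gadget is unreached, hence inactive (`openCluster_union_subset_of_ends_not_mem`, `gadget_inactive`): `K(T ∪ R) ⊆ K(T)`.
Exact pre-check (prim-lf-2 code/gen48/c/gadget.c): all connected `R ∋ u` with `|R| ≤ 4` (n ≤ 5) / `≤ 3` (n = 6, m ≤ 9), all `y ∈ V(R)`, `g = 1_w`: 0 / 6 158 932 negative.
[cite: KozmaNitzan2024, Questions 8–9 (§5.5 p. 36) (context: the Question-8 pocket covariance programme)]
-/

namespace Summit.CriticalPhenomena.PercolationContinuityZ3.Theorems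

open Finset Literature.Probability.Percolation

namespace Coefficientwise

variable {ι V : Type*} [Fintype ι] [DecidableEq ι] (ends : ι → Sym2 V) (x : V)

omit [Fintype ι] in
/-- **Unreached edge sets are inactive.**  If no end of an edge of `A` lies in `C_x(T ∪ A)` then `C_x(T ∪ A) ⊆ C_x(T)`. [cite: KozmaNitzan2024, §5.5 (context only; elementary)] -/
theorem openCluster_union_subset_of_ends_not_mem (T A : Finset ι)
    (hA : ∀ i ∈ A, ∀ v, v ∈ ends i → v ∉ openCluster (ends '' (↑(T ∪ A) : Set ι)) x) :
    openCluster (ends '' (↑(T ∪ A) : Set ι)) x ⊆ openCluster (ends '' (↑T : Set ι)) x := by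
  intro v hv
  obtain ⟨walk⟩ := hv
  have htr : ∀ a ∈ openCluster (ends '' (↑(T ∪ A) : Set ι)) x, ∀ b, (openGraph (ends '' (↑(T ∪ A) : Set ι))).Adj a b →
      (openGraph (ends '' (↑T : Set ι))).Adj a b ∧ b ∈ openCluster (ends '' (↑(T ∪ A) : Set ι)) x := by
    intro a ha b hab
    have hb : b ∈ openCluster (ends '' (↑(T ∪ A) : Set ι)) x := SimpleGraph.Reachable.trans ha hab.reachable
    refine ⟨?_, hb⟩
    rw [openGraph_image_adj] at hab ⊢
    obtain ⟨⟨i, hi, hiab⟩, hne⟩ := hab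
    rcases Finset.mem_union.mp (Finset.mem_coe.mp hi) with hiT | hiA
    · exact ⟨⟨i, hiT, hiab⟩, hne⟩
    · exact absurd ha (hA i hiA a (by rw [hiab]; exact Sym2.mem_mk_left _ _))
  exact ((reachable_transfer (openCluster (ends '' (↑(T ∪ A) : Set ι)) x) htr walk) (mem_openCluster_self _ x)).1

omit [Fintype ι] [DecidableEq ι] in
/-- **Gadget tie.**  If `y` is joined to `u` by `R`-edges then in every colouring containing `R` (as red edges) `y` is red-reached iff `u` is.
[cite: KozmaNitzan2024, §5.5 (context only; elementary)] -/
theorem gadget_tie (R S : Finset ι) (hRS : R ⊆ S) {u y : V} (huy : (openGraph (ends '' (↑R : Set ι))).Reachable u y) :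
    y ∈ openCluster (ends '' (↑S : Set ι)) x ↔ u ∈ openCluster (ends '' (↑S : Set ι)) x := by
  have hmono : (openGraph (ends '' (↑R : Set ι))) ≤ (openGraph (ends '' (↑S : Set ι))) := by
    intro a b hab
    rw [openGraph_image_adj] at hab ⊢
    obtain ⟨⟨i, hi, hiab⟩, hne⟩ := hab
    exact ⟨⟨i, hRS hi, hiab⟩, hne⟩
  have huy' : (openGraph (ends '' (↑S : Set ι))).Reachable u y := huy.mono hmono
  exact ⟨fun h => SimpleGraph.Reachable.trans h huy'.symm, fun h => SimpleGraph.Reachable.trans h huy'⟩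

omit [Fintype ι] in
/-- **An unreached connected gadget is inactive.**  If every end of every `R`-edge is joined to `u` by `R`-edges and `u ∉ C_x(T ∪ R)`, then `C_x(T ∪ R) ⊆ C_x(T)`.
[cite: KozmaNitzan2024, §5.5 (context only; elementary)] -/
theorem gadget_inactive (R T : Finset ι) {u : V} (hR : ∀ i ∈ R, ∀ v, v ∈ ends i → (openGraph (ends '' (↑R : Set ι))).Reachable u v)
    (hu : u ∉ openCluster (ends '' (↑(T ∪ R) : Set ι)) x) :
    openCluster (ends '' (↑(T ∪ R) : Set ι)) x ⊆ openCluster (ends '' (↑T : Set ι)) x := by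
  refine openCluster_union_subset_of_ends_not_mem ends x T R fun i hi v hv hvK => hu ?_
  exact ((gadget_tie ends x R (T ∪ R) Finset.subset_union_right (hR i hi v hv)).mp hvK)

open Classical in
/-- **The all-red class of a connected gadget is nonnegative (sub-cube form).**  `R` connected from `u` (`hR`), `y` joined to `u` inside `R` (`huy`); for `r : Finset {j // j ∉ R}` put
`a(r) = K(r⁺ ∪ R)`, `b(r) = K((rᶜ)⁺ ∪ (R ∖ R))` (`= K((rᶜ)⁺)`).  Then for every monotone `g`:
`0 ≤ Σ_r [¬(y ∈ a r ∧ y ∈ b r)]·([u ∈ a r] − [u ∈ b r])·(g(a r) − g(b r))`. [cite: KozmaNitzan2024, Questions 8–9 (§5.5 p. 36) (context)] -/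
theorem gadgetClass_nonneg_subcube (R : Finset ι) {u y : V} (hR : ∀ i ∈ R, ∀ v, v ∈ ends i → (openGraph (ends '' (↑R : Set ι))).Reachable u v)
    (huy : (openGraph (ends '' (↑R : Set ι))).Reachable u y) (g : Set V → ℝ) (hg : Monotone g) :
    0 ≤ ∑ r : Finset {j : ι // j ∉ R},
      (if ¬ (y ∈ openCluster (ends '' (↑(r.map (Function.Embedding.subtype _) ∪ R) : Set ι)) x ∧
              y ∈ openCluster (ends '' (↑(rᶜ.map (Function.Embedding.subtype _) ∪ (R \ R)) : Set ι)) x) then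
        ((if u ∈ openCluster (ends '' (↑(r.map (Function.Embedding.subtype _) ∪ R) : Set ι)) x then (1 : ℝ) else 0) -
          (if u ∈ openCluster (ends '' (↑(rᶜ.map (Function.Embedding.subtype _) ∪ (R \ R)) : Set ι)) x then (1 : ℝ) else 0)) *
        (g (openCluster (ends '' (↑(r.map (Function.Embedding.subtype _) ∪ R) : Set ι)) x) -
          g (openCluster (ends '' (↑(rᶜ.map (Function.Embedding.subtype _) ∪ (R \ R)) : Set ι)) x))
      else 0) := by
  set emb := Function.Embedding.subtype (fun j : ι => j ∉ R) with hemb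
  set a : Finset {j : ι // j ∉ R} → Set V := fun r => openCluster (ends '' (↑(r.map emb ∪ R) : Set ι)) x with ha
  set a' : Finset {j : ι // j ∉ R} → Set V := fun r => openCluster (ends '' (↑(r.map emb ∪ (R \ R)) : Set ι)) x with ha'
  change 0 ≤ ∑ r : Finset {j : ι // j ∉ R}, (if ¬ (y ∈ a r ∧ y ∈ a' rᶜ) then
    ((if u ∈ a r then (1 : ℝ) else 0) - (if u ∈ a' rᶜ then (1 : ℝ) else 0)) * (g (a r) - g (a' rᶜ)) else 0)
  have hmono_union : ∀ {r t : Finset {j : ι // j ∉ R}} (X : Finset ι), r ⊆ t → r.map emb ∪ X ⊆ t.map emb ∪ X :=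
    fun X hrt => Finset.union_subset_union (Finset.map_subset_map.mpr hrt) (le_refl X)
  have ha_mono : Monotone a := fun r t hrt => openCluster_image_mono ends (hmono_union R hrt) x
  have ha'_mono : Monotone a' := fun r t hrt => openCluster_image_mono ends (hmono_union (R \ R) hrt) x
  have hya : ∀ r, y ∈ a r ↔ u ∈ a r := fun r => gadget_tie ends x R (r.map emb ∪ R) Finset.subset_union_right huy
  have hRR : R \ R = ∅ := Finset.sdiff_self R
  have inact1 : ∀ t : Finset {j : ι // j ∉ R}, u ∉ a' t → a' t ⊆ a t := by
    intro t _ v hv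
    have h1 : t.map emb ∪ (R \ R) ⊆ t.map emb ∪ R := by rw [hRR, Finset.union_empty]; exact Finset.subset_union_left
    exact openCluster_image_mono ends h1 x hv
  have inact2 : ∀ t : Finset {j : ι // j ∉ R}, u ∉ a t → a t ⊆ a' t := by
    intro t hu v hv
    have h1 := gadget_inactive ends x R (t.map emb) hR hu hv
    exact openCluster_image_mono ends Finset.subset_union_left x h1
  -- the rest is the four-bracket argument of the star-class theorem, verbatim
  set E₁ : Finset {j : ι // j ∉ R} → ℝ := fun r => if (u ∈ a r ∧ u ∉ a' rᶜ ∧ y ∉ a' rᶜ) then (1 : ℝ) else 0 with hE₁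
  set E₂ : Finset {j : ι // j ∉ R} → ℝ := fun r => if (u ∈ a' r ∧ u ∉ a rᶜ) then (1 : ℝ) else 0 with hE₂
  set N₂ : Finset {j : ι // j ∉ R} → ℝ := fun r => if (u ∉ a r ∧ u ∈ a' rᶜ) then (1 : ℝ) else 0 with hN₂
  have hpt : ∀ r : Finset {j : ι // j ∉ R}, (if ¬ (y ∈ a r ∧ y ∈ a' rᶜ) then
      ((if u ∈ a r then (1 : ℝ) else 0) - (if u ∈ a' rᶜ then (1 : ℝ) else 0)) * (g (a r) - g (a' rᶜ)) else 0) =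
      E₁ r * (g (a r) - g (a' rᶜ)) - N₂ r * (g (a r) - g (a' rᶜ)) := by
    intro r
    simp only [hE₁, hN₂, hya r]
    by_cases h1 : u ∈ a r <;> by_cases h2 : u ∈ a' rᶜ <;> by_cases h3 : y ∈ a' rᶜ <;> simp [h1, h2, h3]
  rw [Finset.sum_congr rfl (fun r _ => hpt r), Finset.sum_sub_distrib]
  have hswap : ∑ r : Finset {j : ι // j ∉ R}, N₂ r * (g (a r) - g (a' rᶜ)) = - ∑ r : Finset {j : ι // j ∉ R}, E₂ r * (g (a' r) - g (a rᶜ)) := by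
    rw [← Fintype.sum_equiv (Equiv.mk (fun r : Finset {j : ι // j ∉ R} => rᶜ) (fun r => rᶜ) (fun r => compl_compl r) (fun r => compl_compl r))
      (fun r => N₂ rᶜ * (g (a rᶜ) - g (a' rᶜᶜ))) (fun r => N₂ r * (g (a r) - g (a' rᶜ))) (fun r => by simp only [Equiv.coe_fn_mk]),
      ← Finset.sum_neg_distrib]
    refine Finset.sum_congr rfl fun r _ => ?_
    have hNE : N₂ rᶜ = E₂ r := by
      simp only [hN₂, hE₂, compl_compl]
      by_cases h1 : u ∈ a' r <;> by_cases h2 : u ∈ a rᶜ <;> simp [h1, h2]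
    rw [hNE, compl_compl]; ring
  rw [hswap, sub_neg_eq_add]
  have hE₁_mono : Monotone E₁ := by
    intro r t hrt
    simp only [hE₁]
    by_cases hr : u ∈ a r ∧ u ∉ a' rᶜ ∧ y ∉ a' rᶜ
    · have hc : a' tᶜ ⊆ a' rᶜ := ha'_mono (compl_subset_compl.mpr hrt)
      have ht : u ∈ a t ∧ u ∉ a' tᶜ ∧ y ∉ a' tᶜ := ⟨ha_mono hrt hr.1, fun h => hr.2.1 (hc h), fun h => hr.2.2 (hc h)⟩
      simp [hr, ht]
    · simp only [hr, if_false]; split_ifs <;> norm_num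
  have hE₂_mono : Monotone E₂ := by
    intro r t hrt
    simp only [hE₂]
    by_cases hr : u ∈ a' r ∧ u ∉ a rᶜ
    · have hc : a tᶜ ⊆ a rᶜ := ha_mono (compl_subset_compl.mpr hrt)
      have ht : u ∈ a' t ∧ u ∉ a tᶜ := ⟨ha'_mono hrt hr.1, fun h => hr.2 (hc h)⟩
      simp [hr, ht]
    · simp only [hr, if_false]; split_ifs <;> norm_num
  have hB1 : 0 ≤ ∑ r : Finset {j : ι // j ∉ R}, E₁ r * (g (a r) - g (a rᶜ)) :=
    AntitheticProduct.sum_mul_sub_compl_nonneg E₁ (fun r => g (a r)) hE₁_mono (fun r t hrt => hg (ha_mono hrt))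
  have hB2 : 0 ≤ ∑ r : Finset {j : ι // j ∉ R}, E₁ r * (g (a rᶜ) - g (a' rᶜ)) := by
    refine Finset.sum_nonneg fun r _ => ?_
    simp only [hE₁]
    split_ifs with h
    · have hsub : a' rᶜ ⊆ a rᶜ := inact1 rᶜ h.2.1
      have := hg hsub
      linarith
    · simp
  have hB3 : 0 ≤ ∑ r : Finset {j : ι // j ∉ R}, E₂ r * (g (a' r) - g (a' rᶜ)) :=
    AntitheticProduct.sum_mul_sub_compl_nonneg E₂ (fun r => g (a' r)) hE₂_mono (fun r t hrt => hg (ha'_mono hrt))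
  have hB4 : 0 ≤ ∑ r : Finset {j : ι // j ∉ R}, E₂ r * (g (a' rᶜ) - g (a rᶜ)) := by
    refine Finset.sum_nonneg fun r _ => ?_
    simp only [hE₂]
    split_ifs with h
    · have hsub : a rᶜ ⊆ a' rᶜ := inact2 rᶜ h.2
      have := hg hsub
      linarith
    · simp
  have hsplit1 : ∑ r : Finset {j : ι // j ∉ R}, E₁ r * (g (a r) - g (a' rᶜ)) =
      ∑ r : Finset {j : ι // j ∉ R}, E₁ r * (g (a r) - g (a rᶜ)) + ∑ r : Finset {j : ι // j ∉ R}, E₁ r * (g (a rᶜ) - g (a' rᶜ)) := by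
    rw [← Finset.sum_add_distrib]; refine Finset.sum_congr rfl fun r _ => ?_; ring
  have hsplit2 : ∑ r : Finset {j : ι // j ∉ R}, E₂ r * (g (a' r) - g (a rᶜ)) =
      ∑ r : Finset {j : ι // j ∉ R}, E₂ r * (g (a' r) - g (a' rᶜ)) + ∑ r : Finset {j : ι // j ∉ R}, E₂ r * (g (a' rᶜ) - g (a rᶜ)) := by
    rw [← Finset.sum_add_distrib]; refine Finset.sum_congr rfl fun r _ => ?_; ring
  rw [hsplit1, hsplit2]
  linarith

open Classical in
/-- **THEOREM: the all-red class of a connected gadget through the point is nonnegative.**  Let `R` be a finite edge set connected from `u` (every end of an `R`-edge is joined to `u` by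
`R`-edges) with `y` joined to `u` by `R`-edges.  Then for `f = 1[u ∈ ·]` and every monotone `g`:
`0 ≤ Σ_{s ⊇ R : ¬(y ∈ K s ∧ y ∈ K sᶜ)} ([u ∈ K s] − [u ∈ K sᶜ])·(g(K s) − g(K sᶜ))` — the colourings in which the whole gadget is red and `y` is not doubly reached contribute a
nonnegative amount to NO-CORE(y) (and so do, by the colour swap, those in which the whole gadget is blue).  `R` = a single edge `uy` is the star-class theorem; `R` = a path or a tree from
`u` through `y` are the typical instances.  (`sum_cube_eq_sum_powerset_subcube` with `D = R`: only the class `R` itself survives the constraint `R ⊆ s`; then `gadgetClass_nonneg_subcube`.)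
[cite: KozmaNitzan2024, Questions 8–9 (§5.5 p. 36) (context)] -/
theorem gadgetClass_nonneg (R : Finset ι) {u y : V} (hR : ∀ i ∈ R, ∀ v, v ∈ ends i → (openGraph (ends '' (↑R : Set ι))).Reachable u v)
    (huy : (openGraph (ends '' (↑R : Set ι))).Reachable u y) (g : Set V → ℝ) (hg : Monotone g) :
    0 ≤ ∑ s ∈ univ.filter (fun s : Finset ι => R ⊆ s ∧
        ¬ (y ∈ openCluster (ends '' (↑s : Set ι)) x ∧ y ∈ openCluster (ends '' (↑(sᶜ) : Set ι)) x)),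
      ((if u ∈ openCluster (ends '' (↑s : Set ι)) x then (1 : ℝ) else 0) - (if u ∈ openCluster (ends '' (↑(sᶜ) : Set ι)) x then (1 : ℝ) else 0)) *
        (g (openCluster (ends '' (↑s : Set ι)) x) - g (openCluster (ends '' (↑(sᶜ) : Set ι)) x)) := by
  rw [Finset.sum_filter]
  rw [sum_cube_eq_sum_powerset_subcube R (fun s t => if (R ⊆ s ∧ ¬ (y ∈ openCluster (ends '' (↑s : Set ι)) x ∧ y ∈ openCluster (ends '' (↑t : Set ι)) x)) then
      ((if u ∈ openCluster (ends '' (↑s : Set ι)) x then (1 : ℝ) else 0) - (if u ∈ openCluster (ends '' (↑t : Set ι)) x then (1 : ℝ) else 0)) *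
        (g (openCluster (ends '' (↑s : Set ι)) x) - g (openCluster (ends '' (↑t : Set ι)) x)) else 0)]
  -- only the class R' = R survives
  have hvanish : ∀ R' ∈ R.powerset, R' ≠ R → ∑ r : Finset {j : ι // j ∉ R},
      (if (R ⊆ r.map (Function.Embedding.subtype _) ∪ R' ∧
            ¬ (y ∈ openCluster (ends '' (↑(r.map (Function.Embedding.subtype _) ∪ R') : Set ι)) x ∧
               y ∈ openCluster (ends '' (↑(rᶜ.map (Function.Embedding.subtype _) ∪ (R \ R')) : Set ι)) x)) then
        ((if u ∈ openCluster (ends '' (↑(r.map (Function.Embedding.subtype _) ∪ R') : Set ι)) x then (1 : ℝ) else 0) -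
          (if u ∈ openCluster (ends '' (↑(rᶜ.map (Function.Embedding.subtype _) ∪ (R \ R')) : Set ι)) x then (1 : ℝ) else 0)) *
        (g (openCluster (ends '' (↑(r.map (Function.Embedding.subtype _) ∪ R') : Set ι)) x) -
          g (openCluster (ends '' (↑(rᶜ.map (Function.Embedding.subtype _) ∪ (R \ R')) : Set ι)) x))
      else 0) = 0 := by
    intro R' hR' hne
    refine Finset.sum_eq_zero fun r _ => ?_
    have hnot : ¬ (R ⊆ r.map (Function.Embedding.subtype _) ∪ R') := by
      intro hsub
      apply hne
      refine Finset.Subset.antisymm (Finset.mem_powerset.mp hR') fun i hi => ?_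
      rcases Finset.mem_union.mp (hsub hi) with h | h
      · exact absurd hi ((mem_map_subtype_iff (fun j : ι => j ∉ R) r i).mp h).1
      · exact h
    rw [if_neg (fun h => hnot h.1)]
  rw [Finset.sum_eq_single_of_mem R (Finset.mem_powerset.mpr (le_refl R)) (fun R' hR' hne => hvanish R' hR' hne)]
  -- the class R: the constraint `R ⊆ r⁺ ∪ R` holds, and the sum is the sub-cube form
  have hsub : ∀ r : Finset {j : ι // j ∉ R}, R ⊆ r.map (Function.Embedding.subtype _) ∪ R := fun r => Finset.subset_union_right
  have h := gadgetClass_nonneg_subcube ends x R hR huy g hg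
  refine le_trans h (le_of_eq (Finset.sum_congr rfl fun r _ => ?_))
  have hs := hsub r
  split_ifs
  all_goals first | rfl | (exfalso; tauto)

end Coefficientwise

end Summit.CriticalPhenomena.PercolationContinuityZ3.Theorems
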